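import Literature.Barriers.QuantumAdvantage.PSimFPBits
import Literature.Computability.QuantumComplexity.ZWCodeFP
import HarnessLib

/-!
# The `p`-blocked simulator in typed polynomial time, II: tables, the gate step, re-blocking

Topic `Literature/Barriers/QuantumAdvantage`; second file of the polynomial-time certificate (in the
typed `FP` algebra `CodeFP`) of the program `PSim` (`PBlockedSim.lean`), the classical machine of
Jozsa–Linden's lemma `ratpbl` / theorem `pblthm` (Proc. R. Soc. A 459 (2003), §3). With the `ℤ[ω]`
arithmetic of `ZWCodeFP.lean` (`zwE`, `zwAdd`, `zwMul`, `zwConj`, `zwDivInt`, `zwCap`, `zwEq`,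
`posTest`) and the bit lists of `PSimFPBits.lean` (`cfgE`), this file certifies the table layer and
the per-gate primitives of the program:

* codes `keyE`, `entE`, `tabE` (tables = raw lists of keyed `ℤ[ω]` entries), `blkE` (block = mask and
  table), `triE` (gate triples);
* **`lookup_fp`** (a fold whose accumulator is an entry of the table, `foldl_lookup_mem`),
  **`sumZ_fp`** (coordinatewise, through `intSum`), `capZ_fp`, `divZ_fp`, `coef_fp` (a finite table),
  `localCfgs_fp`, `mkTab_fp` (a table of any function computed on codes), `doubleTab_fp`;
* **`gateEntry_fp`**, `gateTab_fp`, `mergeTab_fp`, `traceEntry_fp` — "applying a unitary matrix of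
  size at most `2^{2p} × 2^{2p}`", the merge `ρ_{B₁} ⊗ ρ_{B₂}` and the partial traces (Cases 1 and 2
  of the proof of lemma `ratpbl`);
* the re-blocking primitives `firstNonzeroDiag_fp`, `splitsTest_fp`, `classOf_fp`, `dedupL_fp`
  (folds bounded by their input: `foldl_firstNonzero_mem`, `length_foldl_classOf_le`,
  `foldl_dedup_sublist`) and **`newBlocks_fp`** ("identify a new block structure");
* `touches_fp`, `touchingL_fp`, `untouchedL_fp`, `initBlocks_fp`, `readout_fp`.

The block bound `p` is a fixed parameter of every statement involving `subCfgs` (the polynomial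
degree of the machine depends on it).

## References

* R. Jozsa, N. Linden, *On the role of entanglement in quantum-computational speed-up*, Proc. R. Soc.
  Lond. A 459 (2003) 2011–2032, arXiv:quant-ph/0201143: §3, proof of lemma `ratpbl` ((a), (b),
  Cases 1 and 2, the final read-out), lemma `ratlemma`.
* S. Arora, B. Barak, *Computational Complexity: A Modern Approach*, CUP 2009, §1.3.
-/

noncomputable section

namespace Literature.Barriers.QuantumAdvantage

namespace PSim

open _root_.Computability Polynomial Literature.Computability.Complexity Literature.Computability.Complexity.CodeFP
  Literature.Computability.QuantumComplexity Literature.Computability.QuantumComplexity.ZWCode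

/-! ### Codes -/

/-- The code of a table key (a pair of configurations). [folklore] -/
abbrev keyE : Cfg × Cfg → List Bool := pairE cfgE cfgE

/-- The code of a table entry. [folklore] -/
abbrev entE : (Cfg × Cfg) × ZW → List Bool := pairE keyE zwE

/-- The code of a table. [cite: JozsaLinden2003, §3 (proof of lemma ratpbl, (b) block states)] -/
abbrev tabE : Tab → List Bool := rawE entE

/-- The code of a block (mask and table). [cite: JozsaLinden2003, §3 (proof of lemma ratpbl, (a), (b))] -/
abbrev blkE : Blk → List Bool := pairE cfgE tabE

/-- The code of a gate triple `(op, i, j)`. [folklore] -/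
abbrev triE : ℕ × ℕ × ℕ → List Bool := pairE natE (pairE natE natE)

/-- `keyE` is injective. [folklore] -/
theorem keyE_injective : Function.Injective keyE := pairE_injective cfgE_injective cfgE_injective

/-- Branching on a decidable proposition through its computed bit (local copy of the idiom).
[folklore] -/
theorem iteP {α β : Type} {eα : α → List Bool} {eβ : β → List Bool} {P : α → Prop} [DecidablePred P]
    {g h : α → β} (hp : CodeFP eα bitE (fun a => decide (P a))) (hg : CodeFP eα eβ g) (hh : CodeFP eα eβ h) :
    CodeFP eα eβ (fun a => if P a then g a else h a) :=
  (hp.ite hg hh).congr fun a => by by_cases hP : P a <;> simp [hP]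

/-! ### Lookup -/

/-- The fold behind `lookup` returns its start value or the value of an entry. [folklore] -/
theorem foldl_lookup_mem (key : Cfg × Cfg) : ∀ (T : Tab) (init : ZW),
    T.foldl (fun acc e => if e.1 = key then e.2 else acc) init = init ∨
      ∃ e ∈ T, T.foldl (fun acc e => if e.1 = key then e.2 else acc) init = e.2
  | [], init => Or.inl rfl
  | e :: T, init => by
    rw [List.foldl_cons]
    rcases foldl_lookup_mem key T (if e.1 = key then e.2 else init) with h | ⟨e', he', h⟩
    · by_cases hk : e.1 = key
      · rw [if_pos hk] at h
        exact Or.inr ⟨e, List.mem_cons_self, by rw [if_pos hk, h]⟩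
      · rw [if_neg hk] at h ⊢
        exact Or.inl h
    · exact Or.inr ⟨e', List.mem_cons_of_mem _ he', h⟩

/-- The code of `0 ∈ ℤ[ω]` is short. [folklore] -/
theorem length_zwE_zero : (zwE (0 : ZW)).length ≤ 20 :=
  (length_enc_le (B := 0) fun i => by simp).trans (by norm_num)

/-- **`lookup` on codes.** [cite: JozsaLinden2003, §3 (proof of lemma ratpbl, (b))] -/
theorem lookup_fp : CodeFP (pairE tabE keyE) zwE (fun p => lookup p.1 p.2) := by
  have hkey : CodeFP (pairE keyE (pairE entE zwE)) keyE (fun t => t.1) := (fst _ _ :)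
  have hek : CodeFP (pairE keyE (pairE entE zwE)) keyE (fun t => t.2.1.1) := ((snd _ _).fst'.fst' :)
  have hev : CodeFP (pairE keyE (pairE entE zwE)) zwE (fun t => t.2.1.2) := ((snd _ _).fst'.snd' :)
  have hacc : CodeFP (pairE keyE (pairE entE zwE)) zwE (fun t => t.2.2) := ((snd _ _).snd' :)
  have htest : CodeFP (pairE keyE (pairE entE zwE)) bitE (fun t => decide (t.2.1.1 = t.1)) :=
    ((eq keyE_injective).comp (hek.pair hkey) :)
  have hstep : CodeFP (pairE keyE (pairE entE zwE)) zwE (fun t => if t.2.1.1 = t.1 then t.2.1.2 else t.2.2) :=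
    (iteP htest hev hacc :)
  have h := (foldl (σ := Cfg × Cfg) (α := (Cfg × Cfg) × ZW) (β := ZW) (eσ := keyE) (eα := entE) (eβ := zwE)
    (step := fun key e acc => if e.1 = key then e.2 else acc) (init := fun _ => (0 : ZW)) hstep (const keyE 0)
    (X + 20) (fun key l₁ l₂ => by
      simp only [eval_add, eval_X, eval_ofNat, pairE_apply, length_boolPair]
      rcases foldl_lookup_mem key l₁ 0 with h | ⟨e, he, h⟩
      · rw [h]
        have := length_zwE_zero
        omega
      · rw [h]
        have h1 := length_item_le_length_rawE entE (List.mem_append_left l₂ he)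
        have h2 : (entE e).length = 2 * (keyE e.1).length + 2 + (zwE e.2).length := by
          rw [show entE e = boolPair (keyE e.1) (zwE e.2) from rfl, length_boolPair]
        omega) :)
  exact (h.comp ((snd _ _).pair (fst _ _))).congr fun p => rfl

/-! ### Sums, saturation, division -/

/-- A list sum in `ℤ[ω]`, coordinatewise. [folklore] -/
theorem list_sum_apply (l : List ZW) (k : Fin 4) : l.sum k = (l.map fun z => z k).sum := by
  induction l with
  | nil => rfl
  | cons a l ih => rw [List.sum_cons, List.map_cons, List.sum_cons, Pi.add_apply, ih]

/-- **`sumZ` on codes** (four integer sums). [cite: JozsaLinden2003, §3 (lemma ratlemma)] -/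
theorem sumZ_fp : CodeFP (rawE zwE) zwE sumZ := by
  have hk : ∀ k : Fin 4, CodeFP (rawE zwE) intE (fun l => (l.map fun z => z k).sum) := fun k =>
    (intSum.comp (map₀ (zwCoord k)) :)
  exact (zwMk.comp ((hk 0).pair ((hk 1).pair ((hk 2).pair (hk 3))))).congr fun l => by
    rw [sumZ_eq_sum]
    funext k
    fin_cases k <;> simp [list_sum_apply]

/-- **Saturation `capZ W` on codes**, the width in unary. [folklore] -/
theorem capZ_fp : CodeFP (pairE unE zwE) zwE (fun p => capZ p.1 p.2) :=
  (zwCap.comp ((strOfUn.comp (fst _ _)).pair (snd _ _))).congr fun p => by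
    funext k
    simp [capZ, length_unE]

/-- Coordinatewise division `divZ` on codes. [cite: JozsaLinden2003, §3 (proof of lemma ratpbl, Case 2)] -/
theorem divZ_fp : CodeFP (pairE intE zwE) zwE (fun p => divZ p.1 p.2) := zwDivInt.congr fun _ => rfl

/-! ### The gate coefficients and local configurations -/

/-- The code of four bits. [folklore] -/
abbrev b4E : Bool × Bool × Bool × Bool → List Bool := pairE bitE (pairE bitE (pairE bitE bitE))

/-- `b4E` is injective. [folklore] -/
theorem b4E_injective : Function.Injective b4E :=
  pairE_injective bitE_injective (pairE_injective bitE_injective (pairE_injective bitE_injective bitE_injective))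

/-- **The gate coefficients `coef` on codes** (a case distinction on the symbol number over finite
tables in the four bits). [cite: JozsaLinden2003, §3 (eq. (update))] -/
theorem coef_fp : CodeFP (pairE natE b4E) zwE (fun t => coef t.1 t.2.1 t.2.2.1 t.2.2.2.1 t.2.2.2.2) := by
  have hop : CodeFP (pairE natE b4E) natE (fun t => t.1) := (fst _ _ :)
  have hb : CodeFP (pairE natE b4E) b4E (fun t => t.2) := (snd _ _ :)
  have hH : CodeFP (pairE natE b4E) zwE (fun t => if (t.2.1 && t.2.2.2.1) then -ZW.one else ZW.one) :=
    ((ofFintype b4E_injective zwE (fun b => if (b.1 && b.2.2.1) then -ZW.one else ZW.one)).comp hb :)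
  have hS : CodeFP (pairE natE b4E) zwE (fun t =>
      if t.2.1 = t.2.2.2.1 then (if t.2.1 then ZW.mulOmegaPow 2 ZW.one else ZW.one) else 0) :=
    ((ofFintype b4E_injective zwE (fun b =>
      if b.1 = b.2.2.1 then (if b.1 then ZW.mulOmegaPow 2 ZW.one else ZW.one) else 0)).comp hb :)
  have hT : CodeFP (pairE natE b4E) zwE (fun t =>
      if t.2.1 = t.2.2.2.1 then (if t.2.1 then ZW.mulOmegaPow 1 ZW.one else ZW.one) else 0) :=
    ((ofFintype b4E_injective zwE (fun b =>
      if b.1 = b.2.2.1 then (if b.1 then ZW.mulOmegaPow 1 ZW.one else ZW.one) else 0)).comp hb :)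
  have hC : CodeFP (pairE natE b4E) zwE (fun t =>
      if t.2.1 = t.2.2.2.1 ∧ t.2.2.1 = (t.2.2.2.2 ^^ t.2.2.2.1) then ZW.one else 0) :=
    ((ofFintype b4E_injective zwE (fun b => if b.1 = b.2.2.1 ∧ b.2.1 = (b.2.2.2 ^^ b.2.2.1) then ZW.one else 0)).comp hb :)
  have h0 : CodeFP (pairE natE b4E) bitE (fun t => decide (t.1 = 0)) := (natEq.comp (hop.pair (const _ 0)) :)
  have h1 : CodeFP (pairE natE b4E) bitE (fun t => decide (t.1 = 1)) := (natEq.comp (hop.pair (const _ 1)) :)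
  have h2 : CodeFP (pairE natE b4E) bitE (fun t => decide (t.1 = 2)) := (natEq.comp (hop.pair (const _ 2)) :)
  exact (iteP h0 hH (iteP h1 hS (iteP h2 hT hC))).congr fun t => by
    obtain ⟨op, x₀, x₁, y₀, y₁⟩ := t
    rfl

/-- The local configurations on codes (two constant lists). [folklore] -/
theorem localCfgs_fp : CodeFP natE (rawE (pairE bitE bitE)) localCfgs :=
  ((iteP (natEq.comp ((CodeFP.id natE).pair (const _ 3)))
    (const natE ((bools.map fun a => bools.map fun a' => (a, a')).flatten))
    (const natE (bools.map fun a => (a, false)))).congr fun _ => rfl :)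

/-! ### Tables of a function computed on codes -/

section MkTab

variable {σ : Type} {eσ : σ → List Bool}

/-- **`mkTab` of a function computed on codes**: `(s, keys) ↦ mkTab keys (f s)`.
[cite: JozsaLinden2003, §3 (proof of lemma ratpbl, (b))] -/
theorem mkTab_fp {f : σ → Cfg → Cfg → ZW} (hf : CodeFP (pairE eσ (pairE cfgE cfgE)) zwE (fun t => f t.1 t.2.1 t.2.2)) :
    CodeFP (pairE eσ (rawE cfgE)) tabE (fun q => mkTab q.2 (f q.1)) := by
  -- inner row: context `((s, keys), u)`, item `v`
  have hentry : CodeFP (pairE (pairE (pairE eσ (rawE cfgE)) cfgE) cfgE) entE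
      (fun t => ((t.1.2, t.2), f t.1.1.1 t.1.2 t.2)) :=
    (((fst _ _).snd'.pair (snd _ _)).pair (hf.comp ((fst _ _).fst'.fst'.pair ((fst _ _).snd'.pair (snd _ _)))) :)
  have hrow : CodeFP (pairE (pairE eσ (rawE cfgE)) cfgE) tabE
      (fun t => t.1.2.map fun v => ((t.2, v), f t.1.1 t.2 v)) :=
    (((map hentry).comp ((CodeFP.id _).pair (fst _ _).snd')).congr fun t => rfl :)
  have hrows : CodeFP (pairE eσ (rawE cfgE)) (rawE tabE)
      (fun q => q.2.map fun u => q.2.map fun v => ((u, v), f q.1 u v)) :=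
    (((map hrow).comp ((CodeFP.id _).pair (snd _ _))).congr fun q => rfl :)
  exact ((flatten entE).comp hrows).congr fun q => rfl

end MkTab

/-- `doubleTab W` on codes. [cite: JozsaLinden2003, §3 (proof of lemma ratpbl, Cases 1 and 2)] -/
theorem doubleTab_fp : CodeFP (pairE unE tabE) tabE (fun p => doubleTab p.1 p.2) := by
  have hg : CodeFP (pairE unE entE) entE (fun t => (t.2.1, capZ t.1 (t.2.2 + t.2.2))) :=
    ((snd _ _).fst'.pair (capZ_fp.comp ((fst _ _).pair (zwAdd.comp ((snd _ _).snd'.pair (snd _ _).snd')))) :)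
  exact (map hg).congr fun p => rfl

/-! ### The gate step -/

/-- The input of the gate step: `((op, i, j), T, u, v)`. [folklore] -/
abbrev GateIn : Type := (ℕ × ℕ × ℕ) × Tab × Cfg × Cfg

/-- Its code. [folklore] -/
abbrev gateInE : GateIn → List Bool := pairE triE (pairE tabE (pairE cfgE cfgE))

/-- The context of a summand of the gate step: `((input, a), b)`. [folklore] -/
abbrev GateC2 : Type := (GateIn × (Bool × Bool)) × (Bool × Bool)

/-- Its code. [folklore] -/
abbrev gateC2E : GateC2 → List Bool := pairE (pairE gateInE (pairE bitE bitE)) (pairE bitE bitE)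

/-- **The gate step `gateEntry` on codes.** [cite: JozsaLinden2003, §3 (proof of lemma ratpbl, Cases 1 and 2: "applying a unitary matrix of size at most 2^{2p} × 2^{2p}")] -/
theorem gateEntry_fp : CodeFP gateInE zwE (fun t => gateEntry t.1.1 t.1.2.1 t.1.2.2 t.2.1 t.2.2.1 t.2.2.2) := by
  -- the summand, context `((input, a), b)`
  have hin : CodeFP gateC2E gateInE (fun c => c.1.1) := ((fst _ _).fst' :)
  have ha : CodeFP gateC2E (pairE bitE bitE) (fun c => c.1.2) := ((fst _ _).snd' :)
  have hb : CodeFP gateC2E (pairE bitE bitE) (fun c => c.2) := (snd _ _ :)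
  have htri : CodeFP gateC2E triE (fun c => c.1.1.1) := (hin.fst' :)
  have hi : CodeFP gateC2E natE (fun c => c.1.1.1.2.1) := (htri.snd'.fst' :)
  have hj : CodeFP gateC2E natE (fun c => c.1.1.1.2.2) := (htri.snd'.snd' :)
  have hT : CodeFP gateC2E tabE (fun c => c.1.1.2.1) := (hin.snd'.fst' :)
  have hu : CodeFP gateC2E cfgE (fun c => c.1.1.2.2.1) := (hin.snd'.snd'.fst' :)
  have hv : CodeFP gateC2E cfgE (fun c => c.1.1.2.2.2) := (hin.snd'.snd'.snd' :)
  have hui : CodeFP gateC2E bitE (fun c => c.1.1.2.2.1.getD c.1.1.1.2.1 false) := (getD_fp.comp (hu.pair hi) :)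
  have huj : CodeFP gateC2E bitE (fun c => c.1.1.2.2.1.getD c.1.1.1.2.2 false) := (getD_fp.comp (hu.pair hj) :)
  have hvi : CodeFP gateC2E bitE (fun c => c.1.1.2.2.2.getD c.1.1.1.2.1 false) := (getD_fp.comp (hv.pair hi) :)
  have hvj : CodeFP gateC2E bitE (fun c => c.1.1.2.2.2.getD c.1.1.1.2.2 false) := (getD_fp.comp (hv.pair hj) :)
  have hcoefU : CodeFP gateC2E zwE (fun c => coef c.1.1.1.1 (c.1.1.2.2.1.getD c.1.1.1.2.1 false)
      (c.1.1.2.2.1.getD c.1.1.1.2.2 false) c.1.2.1 c.1.2.2) :=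
    (coef_fp.comp (htri.fst'.pair (hui.pair (huj.pair (ha.fst'.pair ha.snd')))) :)
  have hcoefV : CodeFP gateC2E zwE (fun c => coef c.1.1.1.1 (c.1.1.2.2.2.getD c.1.1.1.2.1 false)
      (c.1.1.2.2.2.getD c.1.1.1.2.2 false) c.2.1 c.2.2) :=
    (coef_fp.comp (htri.fst'.pair (hvi.pair (hvj.pair (hb.fst'.pair hb.snd')))) :)
  have hsetU : CodeFP gateC2E cfgE (fun c => setLocal c.1.1.1.1 c.1.1.1.2.1 c.1.1.1.2.2 c.1.1.2.2.1 c.1.2) :=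
    (setLocal_fp.comp (htri.pair (hu.pair ha)) :)
  have hsetV : CodeFP gateC2E cfgE (fun c => setLocal c.1.1.1.1 c.1.1.1.2.1 c.1.1.1.2.2 c.1.1.2.2.2 c.2) :=
    (setLocal_fp.comp (htri.pair (hv.pair hb)) :)
  have hlook : CodeFP gateC2E zwE (fun c => lookup c.1.1.2.1
      (setLocal c.1.1.1.1 c.1.1.1.2.1 c.1.1.1.2.2 c.1.1.2.2.1 c.1.2, setLocal c.1.1.1.1 c.1.1.1.2.1 c.1.1.1.2.2 c.1.1.2.2.2 c.2)) :=
    (lookup_fp.comp (hT.pair (hsetU.pair hsetV)) :)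
  have hterm : CodeFP gateC2E zwE (fun c =>
      ZW.mul (ZW.mul (coef c.1.1.1.1 (c.1.1.2.2.1.getD c.1.1.1.2.1 false) (c.1.1.2.2.1.getD c.1.1.1.2.2 false) c.1.2.1 c.1.2.2)
        (lookup c.1.1.2.1 (setLocal c.1.1.1.1 c.1.1.1.2.1 c.1.1.1.2.2 c.1.1.2.2.1 c.1.2,
          setLocal c.1.1.1.1 c.1.1.1.2.1 c.1.1.1.2.2 c.1.1.2.2.2 c.2)))
        (ZW.cconj (coef c.1.1.1.1 (c.1.1.2.2.2.getD c.1.1.1.2.1 false) (c.1.1.2.2.2.getD c.1.1.1.2.2 false) c.2.1 c.2.2))) :=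
    (zwMul.comp ((zwMul.comp (hcoefU.pair hlook)).pair (zwConj.comp hcoefV)) :)
  -- inner sum over `b`, context `(input, a)`
  have hloc1 : CodeFP (pairE gateInE (pairE bitE bitE)) (rawE (pairE bitE bitE)) (fun c => localCfgs c.1.1.1) :=
    (localCfgs_fp.comp (fst _ _).fst'.fst' :)
  have hinner : CodeFP (pairE gateInE (pairE bitE bitE)) zwE (fun c => sumZ ((localCfgs c.1.1.1).map fun b =>
      ZW.mul (ZW.mul (coef c.1.1.1 (c.1.2.2.1.getD c.1.1.2.1 false) (c.1.2.2.1.getD c.1.1.2.2 false) c.2.1 c.2.2)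
        (lookup c.1.2.1 (setLocal c.1.1.1 c.1.1.2.1 c.1.1.2.2 c.1.2.2.1 c.2, setLocal c.1.1.1 c.1.1.2.1 c.1.1.2.2 c.1.2.2.2 b)))
        (ZW.cconj (coef c.1.1.1 (c.1.2.2.2.getD c.1.1.2.1 false) (c.1.2.2.2.getD c.1.1.2.2 false) b.1 b.2)))) :=
    ((sumZ_fp.comp ((map hterm).comp ((CodeFP.id _).pair hloc1))).congr fun c => rfl :)
  -- outer sum over `a`
  have hloc0 : CodeFP gateInE (rawE (pairE bitE bitE)) (fun t => localCfgs t.1.1) := (localCfgs_fp.comp (fst _ _).fst' :)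
  exact ((sumZ_fp.comp ((map hinner).comp ((CodeFP.id _).pair hloc0))).congr fun t => rfl)

/-- **`gateTab` on codes**: `((W, g), keys, T) ↦ gateTab W g keys T`.
[cite: JozsaLinden2003, §3 (proof of lemma ratpbl, Cases 1 and 2)] -/
theorem gateTab_fp : CodeFP (pairE (pairE unE triE) (pairE (rawE cfgE) tabE)) tabE
    (fun t => gateTab t.1.1 t.1.2.1 t.1.2.2.1 t.1.2.2.2 t.2.1 t.2.2) := by
  -- the entry function with context `σ = (W, g, T)`
  have hf : CodeFP (pairE (pairE (pairE unE triE) tabE) (pairE cfgE cfgE)) zwE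
      (fun t => capZ t.1.1.1 (gateEntry t.1.1.2.1 t.1.1.2.2.1 t.1.1.2.2.2 t.1.2 t.2.1 t.2.2)) :=
    (capZ_fp.comp ((fst _ _).fst'.fst'.pair (gateEntry_fp.comp ((fst _ _).fst'.snd'.pair ((fst _ _).snd'.pair (snd _ _))))) :)
  have h := (mkTab_fp (σ := (ℕ × (ℕ × ℕ × ℕ)) × Tab) (eσ := pairE (pairE unE triE) tabE)
    (f := fun s u v => capZ s.1.1 (gateEntry s.1.2.1 s.1.2.2.1 s.1.2.2.2 s.2 u v)) hf :)
  exact (h.comp (((fst _ _).pair (snd _ _).snd').pair (snd _ _).fst')).congr fun t => rfl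

/-- The context of the merge: `((W, D), b₁, b₂)`. [folklore] -/
abbrev MergeS : Type := (ℕ × ℤ) × Blk × Blk

/-- Its code. [folklore] -/
abbrev mergeSE : MergeS → List Bool := pairE (pairE unE intE) (pairE blkE blkE)

/-- **`mergeTab` on codes**: `((W, D), (B₁, T₁), (B₂, T₂), keys) ↦ mergeTab W D B₁ T₁ B₂ T₂ keys`.
[cite: JozsaLinden2003, §3 (proof of lemma ratpbl, Case 2: "amalgamating the two block labels")] -/
theorem mergeTab_fp : CodeFP (pairE (pairE unE intE) (pairE blkE (pairE blkE (rawE cfgE)))) tabE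
    (fun t => mergeTab t.1.1 t.1.2 t.2.1.1 t.2.1.2 t.2.2.1.1 t.2.2.1.2 t.2.2.2) := by
  -- entry function with context `σ = ((W, D), b₁, b₂)`
  have hW : CodeFP (pairE mergeSE (pairE cfgE cfgE)) unE (fun t => t.1.1.1) := ((fst _ _).fst'.fst' :)
  have hD : CodeFP (pairE mergeSE (pairE cfgE cfgE)) intE (fun t => t.1.1.2) := ((fst _ _).fst'.snd' :)
  have hB1 : CodeFP (pairE mergeSE (pairE cfgE cfgE)) cfgE (fun t => t.1.2.1.1) := ((fst _ _).snd'.fst'.fst' :)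
  have hT1 : CodeFP (pairE mergeSE (pairE cfgE cfgE)) tabE (fun t => t.1.2.1.2) := ((fst _ _).snd'.fst'.snd' :)
  have hB2 : CodeFP (pairE mergeSE (pairE cfgE cfgE)) cfgE (fun t => t.1.2.2.1) := ((fst _ _).snd'.snd'.fst' :)
  have hT2 : CodeFP (pairE mergeSE (pairE cfgE cfgE)) tabE (fun t => t.1.2.2.2) := ((fst _ _).snd'.snd'.snd' :)
  have hu : CodeFP (pairE mergeSE (pairE cfgE cfgE)) cfgE (fun t => t.2.1) := ((snd _ _).fst' :)
  have hv : CodeFP (pairE mergeSE (pairE cfgE cfgE)) cfgE (fun t => t.2.2) := ((snd _ _).snd' :)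
  have hl1 : CodeFP (pairE mergeSE (pairE cfgE cfgE)) zwE (fun t => lookup t.1.2.1.2 (band t.2.1 t.1.2.1.1, band t.2.2 t.1.2.1.1)) :=
    (lookup_fp.comp (hT1.pair ((band_fp.comp (hu.pair hB1)).pair (band_fp.comp (hv.pair hB1)))) :)
  have hl2 : CodeFP (pairE mergeSE (pairE cfgE cfgE)) zwE (fun t => lookup t.1.2.2.2 (band t.2.1 t.1.2.2.1, band t.2.2 t.1.2.2.1)) :=
    (lookup_fp.comp (hT2.pair ((band_fp.comp (hu.pair hB2)).pair (band_fp.comp (hv.pair hB2)))) :)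
  have hf : CodeFP (pairE mergeSE (pairE cfgE cfgE)) zwE (fun t => capZ t.1.1.1 (divZ t.1.1.2
      (ZW.mul (lookup t.1.2.1.2 (band t.2.1 t.1.2.1.1, band t.2.2 t.1.2.1.1))
        (lookup t.1.2.2.2 (band t.2.1 t.1.2.2.1, band t.2.2 t.1.2.2.1))))) :=
    (capZ_fp.comp (hW.pair (divZ_fp.comp (hD.pair (zwMul.comp (hl1.pair hl2))))) :)
  have h := (mkTab_fp (σ := MergeS) (eσ := mergeSE) (f := fun s u v => capZ s.1.1 (divZ s.1.2
      (ZW.mul (lookup s.2.1.2 (band u s.2.1.1, band v s.2.1.1)) (lookup s.2.2.2 (band u s.2.2.1, band v s.2.2.1))))) hf :)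
  exact (h.comp (((fst _ _).pair ((snd _ _).fst'.pair (snd _ _).snd'.fst')).pair (snd _ _).snd'.snd')).congr fun t => rfl

/-- The input of a partial-trace entry: `((C, A), T, u, v)`. [folklore] -/
abbrev TraceIn : Type := (Cfg × Cfg) × Tab × Cfg × Cfg

/-- Its code. [folklore] -/
abbrev traceInE : TraceIn → List Bool := pairE (pairE cfgE cfgE) (pairE tabE (pairE cfgE cfgE))

/-- **`traceEntry p` on codes**: `((C, A), T, u, v) ↦ traceEntry p C A T u v`.
[cite: JozsaLinden2003, §3 (proof of lemma ratpbl, Case 2: "compute the reduced state ρ_X of every subset")] -/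
theorem traceEntry_fp (p : ℕ) : CodeFP (pairE (pairE cfgE cfgE) (pairE tabE (pairE cfgE cfgE))) zwE
    (fun t => traceEntry p t.1.1 t.1.2 t.2.1 t.2.2.1 t.2.2.2) := by
  have hterm : CodeFP (pairE traceInE cfgE) zwE (fun c => lookup c.1.2.1 (bor c.1.2.2.1 c.2, bor c.1.2.2.2 c.2)) :=
    (lookup_fp.comp ((fst _ _).snd'.fst'.pair ((bor_fp.comp ((fst _ _).snd'.snd'.fst'.pair (snd _ _))).pair
      (bor_fp.comp ((fst _ _).snd'.snd'.snd'.pair (snd _ _))))) :)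
  have hsub : CodeFP traceInE (rawE cfgE) (fun s => subCfgs p (bandnot s.1.1 s.1.2)) :=
    ((subCfgs_fp p).comp (bandnot_fp.comp (fst _ _)) :)
  exact ((sumZ_fp.comp ((map hterm).comp ((CodeFP.id _).pair hsub))).congr fun t => rfl)

/-! ### Re-blocking -/

/-- The fold behind `firstNonzeroDiag` returns its start configuration or a key. [folklore] -/
theorem foldl_firstNonzero_mem (T : Tab) : ∀ (keys : List Cfg) (acc : Bool × Cfg),
    (keys.foldl (fun acc u => if acc.1 then acc else if lookup T (u, u) = 0 then acc else (true, u)) acc).2 = acc.2 ∨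
      (keys.foldl (fun acc u => if acc.1 then acc else if lookup T (u, u) = 0 then acc else (true, u)) acc).2 ∈ keys
  | [], acc => Or.inl rfl
  | u :: keys, acc => by
    rw [List.foldl_cons]
    rcases foldl_firstNonzero_mem T keys (if acc.1 then acc else if lookup T (u, u) = 0 then acc else (true, u)) with h | h
    · rw [h]
      by_cases h1 : acc.1 = true
      · simp [h1]
      · by_cases h2 : lookup T (u, u) = 0
        · simp [h1, h2]
        · simp [h1, h2]
    · exact Or.inr (List.mem_cons_of_mem _ h)

/-- The context of the search for a nonzero diagonal entry: `(N, T)`. [folklore] -/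
abbrev FnzS : Type := ℕ × Tab

/-- Its code. [folklore] -/
abbrev fnzSE : FnzS → List Bool := pairE unE tabE

/-- **`firstNonzeroDiag` on codes**: `(N, keys, T) ↦ firstNonzeroDiag N keys T` (`N` unary).
[cite: JozsaLinden2003, §3 (proof of lemma ratpbl, Case 2)] -/
theorem firstNonzeroDiag_fp : CodeFP (pairE unE (pairE (rawE cfgE) tabE)) cfgE
    (fun t => firstNonzeroDiag t.1 t.2.1 t.2.2) := by
  -- context `σ = (N, T)`, items `u`, accumulator `(flag, cfg)`
  have hflag : CodeFP (pairE fnzSE (pairE cfgE (pairE bitE cfgE))) bitE (fun t => t.2.2.1) := ((snd _ _).snd'.fst' :)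
  have hacc : CodeFP (pairE fnzSE (pairE cfgE (pairE bitE cfgE))) (pairE bitE cfgE) (fun t => t.2.2) := ((snd _ _).snd' :)
  have hu : CodeFP (pairE fnzSE (pairE cfgE (pairE bitE cfgE))) cfgE (fun t => t.2.1) := ((snd _ _).fst' :)
  have hT : CodeFP (pairE fnzSE (pairE cfgE (pairE bitE cfgE))) tabE (fun t => t.1.2) := ((fst _ _).snd' :)
  have hzero : CodeFP (pairE fnzSE (pairE cfgE (pairE bitE cfgE))) bitE (fun t => decide (lookup t.1.2 (t.2.1, t.2.1) = 0)) :=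
    (zwIsZero.comp (lookup_fp.comp (hT.pair (hu.pair hu))) :)
  have hnew : CodeFP (pairE fnzSE (pairE cfgE (pairE bitE cfgE))) (pairE bitE cfgE) (fun t => (true, t.2.1)) :=
    ((const _ true).pair hu :)
  have hstep : CodeFP (pairE fnzSE (pairE cfgE (pairE bitE cfgE))) (pairE bitE cfgE)
      (fun t => if t.2.2.1 then t.2.2 else if lookup t.1.2 (t.2.1, t.2.1) = 0 then t.2.2 else (true, t.2.1)) :=
    (hflag.ite hacc (iteP hzero hacc hnew) :)
  have hinit : CodeFP fnzSE (pairE bitE cfgE) (fun s => (false, zeros s.1)) := ((const _ false).pair (zeros_fp.comp (fst _ _)) :)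
  have h := (foldl (σ := FnzS) (α := Cfg) (β := Bool × Cfg) (eσ := fnzSE) (eα := cfgE) (eβ := pairE bitE cfgE)
    (step := fun s u acc => if acc.1 then acc else if lookup s.2 (u, u) = 0 then acc else (true, u))
    (init := fun s => (false, zeros s.1)) hstep hinit (X + 3) (fun s l₁ l₂ => by
      simp only [eval_add, eval_X, eval_ofNat, pairE_apply, length_boolPair]
      set r := l₁.foldl (fun acc u => if acc.1 then acc else if lookup s.2 (u, u) = 0 then acc else (true, u))
        (false, zeros s.1) with hr
      have hbit : (bitE r.1).length = 1 := rfl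
      rcases foldl_firstNonzero_mem s.2 l₁ (false, zeros s.1) with h | h
      · rw [← hr] at h
        rw [h, length_cfgE, PSim.zeros, List.length_replicate, length_unE]
        omega
      · rw [← hr] at h
        have := length_item_le_length_rawE cfgE (List.mem_append_left l₂ h)
        omega) :)
  exact (h.snd'.comp (((fst _ _).pair (snd _ _).snd').pair (snd _ _).fst')).congr fun t => rfl

/-- The input of the split test: `((keys, T), y₀, S)`. [folklore] -/
abbrev SplitIn : Type := (List Cfg × Tab) × Cfg × Cfg

/-- Its code. [folklore] -/
abbrev splitInE : SplitIn → List Bool := pairE (pairE (rawE cfgE) tabE) (pairE cfgE cfgE)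

/-- The context of one rank-one identity: `((input, u), v)`. [folklore] -/
abbrev SplitC2 : Type := (SplitIn × Cfg) × Cfg

/-- Its code. [folklore] -/
abbrev splitC2E : SplitC2 → List Bool := pairE (pairE splitInE cfgE) cfgE

/-- **The split test on codes**: `((keys, T), y₀, S) ↦ splitsTest keys T y₀ S`.
[cite: JozsaLinden2003, §3 (proof of lemma ratpbl, Case 2: "looking for an equality of states")] -/
theorem splitsTest_fp : CodeFP (pairE (pairE (rawE cfgE) tabE) (pairE cfgE cfgE)) bitE
    (fun t => splitsTest t.1.1 t.1.2 t.2.1 t.2.2) := by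
  -- the test, context `((s, u), v)`
  have hT : CodeFP splitC2E tabE (fun c => c.1.1.1.2) := ((fst _ _).fst'.fst'.snd' :)
  have hy : CodeFP splitC2E cfgE (fun c => c.1.1.2.1) := ((fst _ _).fst'.snd'.fst' :)
  have hS : CodeFP splitC2E cfgE (fun c => c.1.1.2.2) := ((fst _ _).fst'.snd'.snd' :)
  have hu : CodeFP splitC2E cfgE (fun c => c.1.2) := ((fst _ _).snd' :)
  have hv : CodeFP splitC2E cfgE (fun c => c.2) := (snd _ _ :)
  have hl : ∀ {g : SplitC2 → Cfg}, CodeFP splitC2E cfgE g → CodeFP splitC2E zwE (fun c => lookup c.1.1.1.2 (g c, c.1.1.2.1)) :=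
    fun hg => (lookup_fp.comp (hT.pair (hg.pair hy)) :)
  have htest : CodeFP splitC2E bitE (fun c => decide (ZW.mul (lookup c.1.1.1.2 (c.1.2, c.1.1.2.1)) (lookup c.1.1.1.2 (c.2, c.1.1.2.1)) =
      ZW.mul (lookup c.1.1.1.2 (pw c.1.1.2.2 c.1.2 c.2, c.1.1.2.1)) (lookup c.1.1.1.2 (pw c.1.1.2.2 c.2 c.1.2, c.1.1.2.1)))) :=
    (zwEq.comp ((zwMul.comp ((hl hu).pair (hl hv))).pair (zwMul.comp ((hl (pw_fp.comp (hS.pair (hu.pair hv)))).pair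
      (hl (pw_fp.comp (hS.pair (hv.pair hu))))))) :)
  have hinner : CodeFP (pairE splitInE cfgE) bitE (fun c => c.1.1.1.all fun v =>
      decide (ZW.mul (lookup c.1.1.2 (c.2, c.1.2.1)) (lookup c.1.1.2 (v, c.1.2.1)) =
        ZW.mul (lookup c.1.1.2 (pw c.1.2.2 c.2 v, c.1.2.1)) (lookup c.1.1.2 (pw c.1.2.2 v c.2, c.1.2.1)))) :=
    (((all htest).comp ((CodeFP.id _).pair (fst _ _).fst'.fst')).congr fun c => rfl :)
  exact (((all hinner).comp ((CodeFP.id _).pair (fst _ _).fst')).congr fun t => rfl)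

/-- The fold behind `classOf` does not lengthen its accumulator. [folklore] -/
theorem length_foldl_classOf_le (a : ℕ) : ∀ (l : List Cfg) (C : Cfg),
    (l.foldl (fun acc S => if S.getD a false then band acc S else acc) C).length ≤ C.length
  | [], C => le_rfl
  | S :: l, C => by
    rw [List.foldl_cons]
    refine (length_foldl_classOf_le a l _).trans ?_
    split_ifs
    · simp [band, List.length_zipWith]
    · exact le_rfl

/-- The context of the class computation: `(C, a)`. [folklore] -/
abbrev ClassS : Type := Cfg × ℕ

/-- Its code. [folklore] -/
abbrev classSE : ClassS → List Bool := pairE cfgE natE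

/-- **`classOf` on codes**: `(C, splitting, a) ↦ classOf C splitting a`.
[cite: JozsaLinden2003, §3 (proof of lemma ratpbl, Case 2: "identify a new block structure")] -/
theorem classOf_fp : CodeFP (pairE cfgE (pairE (rawE cfgE) natE)) cfgE (fun t => classOf t.1 t.2.1 t.2.2) := by
  have hS : CodeFP (pairE classSE (pairE cfgE cfgE)) cfgE (fun t => t.2.1) := ((snd _ _).fst' :)
  have hacc : CodeFP (pairE classSE (pairE cfgE cfgE)) cfgE (fun t => t.2.2) := ((snd _ _).snd' :)
  have htest : CodeFP (pairE classSE (pairE cfgE cfgE)) bitE (fun t => t.2.1.getD t.1.2 false) :=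
    (getD_fp.comp (hS.pair (fst _ _).snd') :)
  have hstep : CodeFP (pairE classSE (pairE cfgE cfgE)) cfgE (fun t => if t.2.1.getD t.1.2 false then band t.2.2 t.2.1 else t.2.2) :=
    (htest.ite (band_fp.comp (hacc.pair hS)) hacc :)
  have h := (foldl (σ := ClassS) (α := Cfg) (β := Cfg) (eσ := classSE) (eα := cfgE) (eβ := cfgE)
    (step := fun s S acc => if S.getD s.2 false then band acc S else acc) (init := fun s => s.1) hstep (fst _ _) X
    (fun s l₁ l₂ => by
      simp only [eval_X, pairE_apply, length_boolPair]
      have := length_foldl_classOf_le s.2 l₁ s.1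
      rw [length_cfgE, length_cfgE]
      omega) :)
  exact (h.comp (((fst _ _).pair (snd _ _).snd').pair (snd _ _).fst')).congr fun t => rfl

/-- The fold behind `dedupL` appends a sublist of its input. [folklore] -/
theorem foldl_dedup_sublist : ∀ (l acc : List Cfg),
    ∃ l' : List Cfg, l'.Sublist l ∧ l.foldl (fun acc a => if a ∈ acc then acc else acc ++ [a]) acc = acc ++ l'
  | [], acc => ⟨[], List.Sublist.slnil, by simp⟩
  | a :: l, acc => by
    rw [List.foldl_cons]
    by_cases ha : a ∈ acc
    · rw [if_pos ha]
      obtain ⟨l', hl', h⟩ := foldl_dedup_sublist l acc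
      exact ⟨l', hl'.trans (List.sublist_cons_self a l), h⟩
    · rw [if_neg ha]
      obtain ⟨l', hl', h⟩ := foldl_dedup_sublist l (acc ++ [a])
      exact ⟨a :: l', hl'.cons_cons a, by rw [h, List.append_assoc]; rfl⟩

/-- **`dedupL` on codes.** [folklore] -/
theorem dedupL_fp : CodeFP (rawE cfgE) (rawE cfgE) dedupL := by
  have hmem : CodeFP (pairE cfgE (rawE cfgE)) bitE (fun t => decide (t.1 ∈ t.2)) := (mem cfgE_injective :)
  have hstep : CodeFP (pairE cfgE (rawE cfgE)) (rawE cfgE) (fun t => if t.1 ∈ t.2 then t.2 else t.2 ++ [t.1]) :=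
    (iteP hmem (snd _ _) ((rawAppend cfgE).comp ((snd _ _).pair ((rawSingleton cfgE).comp (fst _ _)))) :)
  have h := (foldl₀ (α := Cfg) (β := List Cfg) (eα := cfgE) (eβ := rawE cfgE)
    (step := fun a acc => if a ∈ acc then acc else acc ++ [a]) (b₀ := []) hstep X (fun l₁ l₂ => by
      rw [eval_X]
      obtain ⟨l', hl', h⟩ := foldl_dedup_sublist l₁ []
      rw [h, List.nil_append]
      exact length_rawE_le_of_sublist cfgE (hl'.trans (List.sublist_append_left l₁ l₂))) :)
  exact h.congr fun l => rfl

/-- The input of the re-blocking: `(N, W, C, keys, T)` (`N`, `W` unary). [folklore] -/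
abbrev NewIn : Type := ℕ × ℕ × Cfg × List Cfg × Tab

/-- Its code. [folklore] -/
abbrev newInE : NewIn → List Bool := pairE unE (pairE unE (pairE cfgE (pairE (rawE cfgE) tabE)))

/-- **The re-blocking `newBlocks p` on codes.**
[cite: JozsaLinden2003, §3 (proof of lemma ratpbl, Case 2: "identify a new block structure … within the qubits of B₁ and B₂")] -/
theorem newBlocks_fp (p : ℕ) : CodeFP newInE (rawE blkE) (fun t => newBlocks p t.1 t.2.1 t.2.2.1 t.2.2.2.1 t.2.2.2.2) := by
  have hN : CodeFP newInE unE (fun t => t.1) := (fst _ _ :)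
  have hW : CodeFP newInE unE (fun t => t.2.1) := ((snd _ _).fst' :)
  have hC : CodeFP newInE cfgE (fun t => t.2.2.1) := ((snd _ _).snd'.fst' :)
  have hkeys : CodeFP newInE (rawE cfgE) (fun t => t.2.2.2.1) := ((snd _ _).snd'.snd'.fst' :)
  have hT : CodeFP newInE tabE (fun t => t.2.2.2.2) := ((snd _ _).snd'.snd'.snd' :)
  have hy : CodeFP newInE cfgE (fun t => firstNonzeroDiag t.1 t.2.2.2.1 t.2.2.2.2) :=
    (firstNonzeroDiag_fp.comp (hN.pair (hkeys.pair hT)) :)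
  -- the splitting sub-masks
  have hsplitTest : CodeFP (pairE newInE cfgE) bitE (fun c => splitsTest c.1.2.2.2.1 c.1.2.2.2.2
      (firstNonzeroDiag c.1.1 c.1.2.2.2.1 c.1.2.2.2.2) c.2) :=
    (splitsTest_fp.comp (((hkeys.comp (fst _ _)).pair (hT.comp (fst _ _))).pair ((hy.comp (fst _ _)).pair (snd _ _))) :)
  have hsplitting : CodeFP newInE (rawE cfgE) (fun t => (subCfgs p t.2.2.1).filter fun S =>
      splitsTest t.2.2.2.1 t.2.2.2.2 (firstNonzeroDiag t.1 t.2.2.2.1 t.2.2.2.2) S) :=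
    (((CodeFP.filter hsplitTest).comp ((CodeFP.id _).pair ((subCfgs_fp p).comp hC))).congr fun t => rfl :)
  -- the classes
  have hsel : CodeFP (pairE newInE natE) bitE (fun c => c.1.2.2.1.getD c.2 false) := (getD_fp.comp ((hC.comp (fst _ _)).pair (snd _ _)) :)
  have hwires : CodeFP newInE (rawE natE) (fun t => (List.range t.1).filter fun a => t.2.2.1.getD a false) :=
    (((CodeFP.filter hsel).comp ((CodeFP.id _).pair (urange.comp hN))).congr fun t => rfl :)
  have hclass : CodeFP (pairE (pairE newInE (rawE cfgE)) natE) cfgE (fun c => classOf c.1.1.2.2.1 c.1.2 c.2) :=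
    (classOf_fp.comp ((hC.comp (fst _ _).fst').pair ((fst _ _).snd'.pair (snd _ _))) :)
  have hclasses : CodeFP newInE (rawE cfgE) (fun t => dedupL (((List.range t.1).filter fun a => t.2.2.1.getD a false).map
      fun a => classOf t.2.2.1 ((subCfgs p t.2.2.1).filter fun S =>
        splitsTest t.2.2.2.1 t.2.2.2.2 (firstNonzeroDiag t.1 t.2.2.2.1 t.2.2.2.2) S) a)) :=
    ((dedupL_fp.comp ((map hclass).comp (((CodeFP.id _).pair hsplitting).pair hwires))).congr fun t => rfl :)
  -- the new tables: context `σ = (input, A)`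
  have htrace : CodeFP (pairE (pairE newInE cfgE) (pairE cfgE cfgE)) zwE
      (fun c => capZ c.1.1.2.1 (traceEntry p c.1.1.2.2.1 c.1.2 c.1.1.2.2.2.2 c.2.1 c.2.2)) :=
    (capZ_fp.comp ((hW.comp (fst _ _).fst').pair ((traceEntry_fp p).comp
      ((((hC.comp (fst _ _).fst').pair (fst _ _).snd').pair ((hT.comp (fst _ _).fst').pair (snd _ _)))))) :)
  have htab := (mkTab_fp (σ := NewIn × Cfg) (eσ := pairE newInE cfgE)
    (f := fun s u v => capZ s.1.2.1 (traceEntry p s.1.2.2.1 s.2 s.1.2.2.2.2 u v)) htrace :)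
  have hblk : CodeFP (pairE newInE cfgE) blkE (fun c => (c.2, mkTab (subCfgs p c.2)
      (fun u v => capZ c.1.2.1 (traceEntry p c.1.2.2.1 c.2 c.1.2.2.2.2 u v)))) :=
    ((snd _ _).pair (htab.comp ((CodeFP.id _).pair ((subCfgs_fp p).comp (snd _ _)))) :)
  exact (((map hblk).comp ((CodeFP.id _).pair hclasses)).congr fun t => rfl)

/-! ### Touching blocks, the initial blocks, the read-out -/

/-- The touching test on codes: `(g, b) ↦ touches g.1 g.2.1 g.2.2 b`. [cite: JozsaLinden2003, §3 (proof of lemma ratpbl, Cases 1 and 2)] -/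
theorem touches_fp : CodeFP (pairE triE blkE) bitE (fun t => touches t.1.1 t.1.2.1 t.1.2.2 t.2) := by
  have hm : CodeFP (pairE triE blkE) cfgE (fun t => t.2.1) := ((snd _ _).fst' :)
  have h1 : CodeFP (pairE triE blkE) bitE (fun t => t.2.1.getD t.1.2.1 false) := (getD_fp.comp (hm.pair (fst _ _).snd'.fst') :)
  have h2 : CodeFP (pairE triE blkE) bitE (fun t => t.2.1.getD t.1.2.2 false) := (getD_fp.comp (hm.pair (fst _ _).snd'.snd') :)
  have h3 : CodeFP (pairE triE blkE) bitE (fun t => decide (t.1.1 = 3)) := (natEq.comp ((fst _ _).fst'.pair (const _ 3)) :)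
  exact (h1.or (h3.and h2)).congr fun t => rfl

/-- `touchingL` on codes. [cite: JozsaLinden2003, §3 (proof of lemma ratpbl, Cases 1 and 2)] -/
theorem touchingL_fp : CodeFP (pairE triE (rawE blkE)) (rawE blkE) (fun t => touchingL t.1.1 t.1.2.1 t.1.2.2 t.2) :=
  (CodeFP.filter touches_fp).congr fun _ => rfl

/-- `untouchedL` on codes. [cite: JozsaLinden2003, §3 (proof of lemma ratpbl, Cases 1 and 2)] -/
theorem untouchedL_fp : CodeFP (pairE triE (rawE blkE)) (rawE blkE) (fun t => untouchedL t.1.1 t.1.2.1 t.1.2.2 t.2) :=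
  ((CodeFP.filter touches_fp.not).congr fun _ => rfl :)

/-- The context of an initial block: `((N, w₀), i)`. [folklore] -/
abbrev InitS : Type := (ℕ × Cfg) × ℕ

/-- Its code. [folklore] -/
abbrev initSE : InitS → List Bool := pairE (pairE unE cfgE) natE

/-- **The initial blocks on codes**: `(N, w₀) ↦ initBlocks N w₀` (`N` unary).
[cite: JozsaLinden2003, §3 (proof of lemma ratpbl: the input row |i₁…iₙ⟩|0…0⟩)] -/
theorem initBlocks_fp : CodeFP (pairE unE cfgE) (rawE blkE) (fun t => initBlocks t.1 t.2) := by
  -- table function, context `σ = ((N, w₀), i)`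
  have hi : CodeFP (pairE initSE (pairE cfgE cfgE)) natE (fun t => t.1.2) := ((fst _ _).snd' :)
  have hw : CodeFP (pairE initSE (pairE cfgE cfgE)) bitE (fun t => t.1.1.2.getD t.1.2 false) := (getD_fp.comp ((fst _ _).fst'.snd'.pair hi) :)
  have hu : CodeFP (pairE initSE (pairE cfgE cfgE)) bitE (fun t => t.2.1.getD t.1.2 false) := (getD_fp.comp ((snd _ _).fst'.pair hi) :)
  have hv : CodeFP (pairE initSE (pairE cfgE cfgE)) bitE (fun t => t.2.2.getD t.1.2 false) := (getD_fp.comp ((snd _ _).snd'.pair hi) :)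
  have htest : CodeFP (pairE initSE (pairE cfgE cfgE)) bitE
      (fun t => decide (t.2.1.getD t.1.2 false = t.1.1.2.getD t.1.2 false ∧ t.2.2.getD t.1.2 false = t.1.1.2.getD t.1.2 false)) :=
    (((eq bitE_injective).comp (hu.pair hw)).and ((eq bitE_injective).comp (hv.pair hw))).congr fun t => by
      simp
  have hf : CodeFP (pairE initSE (pairE cfgE cfgE)) zwE (fun t =>
      if t.2.1.getD t.1.2 false = t.1.1.2.getD t.1.2 false ∧ t.2.2.getD t.1.2 false = t.1.1.2.getD t.1.2 false then ZW.one else 0) :=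
    (iteP htest (const _ ZW.one) (const _ 0) :)
  have htab := (mkTab_fp (σ := InitS) (eσ := initSE) (f := fun s u v =>
    if u.getD s.2 false = s.1.2.getD s.2 false ∧ v.getD s.2 false = s.1.2.getD s.2 false then ZW.one else 0) hf :)
  have hone : CodeFP initSE cfgE (fun s => oneHot s.1.1 s.2) := (oneHot_fp.comp ((fst _ _).fst'.pair (snd _ _)) :)
  have hkeys : CodeFP initSE (rawE cfgE) (fun s => [zeros s.1.1, oneHot s.1.1 s.2]) :=
    ((rawCons cfgE).comp ((zeros_fp.comp (fst _ _).fst').pair ((rawSingleton cfgE).comp hone)) :)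
  have hblk : CodeFP initSE blkE (fun s => (oneHot s.1.1 s.2, mkTab [zeros s.1.1, oneHot s.1.1 s.2] (fun u v =>
      if u.getD s.2 false = s.1.2.getD s.2 false ∧ v.getD s.2 false = s.1.2.getD s.2 false then ZW.one else 0))) :=
    (hone.pair (htab.comp ((CodeFP.id _).pair hkeys)) :)
  exact (((map hblk).comp ((CodeFP.id _).pair (urange.comp (fst _ _)))).congr fun t => rfl)

/-- The code of a machine state `(D, blocks)`. [cite: JozsaLinden2003, §3 (proof of lemma ratpbl, (a), (b))] -/
abbrev stE : ℤ × List Blk → List Bool := pairE intE (rawE blkE)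

/-- The input of the read-out: `((N, W), st)`. [folklore] -/
abbrev ReadIn : Type := (ℕ × ℕ) × (ℤ × List Blk)

/-- Its code. [folklore] -/
abbrev readInE : ReadIn → List Bool := pairE (pairE unE unE) stE

/-- **The read-out on codes**: `((N, W), st) ↦ readout ⟨p, N, W⟩ st` (`N`, `W` unary).
[cite: JozsaLinden2003, §3 (proof of lemma ratpbl, final step: "identify the block containing the leftmost qubit")] -/
theorem readout_fp (p : ℕ) : CodeFP (pairE (pairE unE unE) stE) bitE (fun t => readout ⟨p, t.1.1, t.1.2⟩ t.2) := by
  have hN : CodeFP readInE unE (fun t => t.1.1) := ((fst _ _).fst' :)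
  have hD : CodeFP readInE intE (fun t => t.2.1) := ((snd _ _).fst' :)
  have hblocks : CodeFP readInE (rawE blkE) (fun t => t.2.2) := ((snd _ _).snd' :)
  -- the block of wire 0
  have hsel : CodeFP (pairE readInE blkE) bitE (fun c => c.2.1.getD 0 false) := (getD_fp.comp ((snd _ _).fst'.pair (const _ 0)) :)
  have hfilter : CodeFP readInE (rawE blkE) (fun t => t.2.2.filter fun b => b.1.getD 0 false) :=
    (((CodeFP.filter hsel).comp ((CodeFP.id _).pair hblocks)).congr fun t => rfl :)
  have hdef : CodeFP readInE blkE (fun t => (zeros t.1.1, ([] : Tab))) := ((zeros_fp.comp hN).pair (const _ []) :)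
  have hb : CodeFP readInE blkE (fun t => (t.2.2.filter fun b => b.1.getD 0 false).getD 0 (zeros t.1.1, [])) :=
    ((rawGetOr blkE).comp (hfilter.pair ((const _ 0).pair hdef)) :)
  -- the diagonal sum
  have hdsel : CodeFP (pairE readInE cfgE) bitE (fun c => c.2.getD 0 false) := (getD_fp.comp ((snd _ _).pair (const _ 0)) :)
  have hkeys : CodeFP readInE (rawE cfgE) (fun t => (subCfgs p ((t.2.2.filter fun b => b.1.getD 0 false).getD 0 (zeros t.1.1, [])).1).filter
      fun u => u.getD 0 false) :=
    (((CodeFP.filter hdsel).comp ((CodeFP.id _).pair ((subCfgs_fp p).comp hb.fst'))).congr fun t => rfl :)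
  have hterm : CodeFP (pairE readInE cfgE) zwE (fun c => lookup ((c.1.2.2.filter fun b => b.1.getD 0 false).getD 0 (zeros c.1.1.1, [])).2
      (c.2, c.2)) :=
    (lookup_fp.comp ((hb.comp (fst _ _)).snd'.pair ((snd _ _).pair (snd _ _))) :)
  have hd : CodeFP readInE zwE (fun t => sumZ (((subCfgs p ((t.2.2.filter fun b => b.1.getD 0 false).getD 0 (zeros t.1.1, [])).1).filter
      fun u => u.getD 0 false).map fun u => lookup ((t.2.2.filter fun b => b.1.getD 0 false).getD 0 (zeros t.1.1, [])).2 (u, u))) :=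
    ((sumZ_fp.comp ((map hterm).comp ((CodeFP.id _).pair hkeys))).congr fun t => rfl :)
  have htest : CodeFP readInE bitE (fun t => posSqrtTwoTest
      (2 * (sumZ (((subCfgs p ((t.2.2.filter fun b => b.1.getD 0 false).getD 0 (zeros t.1.1, [])).1).filter
        fun u => u.getD 0 false).map fun u => lookup ((t.2.2.filter fun b => b.1.getD 0 false).getD 0 (zeros t.1.1, [])).2 (u, u))) 0 - t.2.1)
      (2 * (sumZ (((subCfgs p ((t.2.2.filter fun b => b.1.getD 0 false).getD 0 (zeros t.1.1, [])).1).filter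
        fun u => u.getD 0 false).map fun u => lookup ((t.2.2.filter fun b => b.1.getD 0 false).getD 0 (zeros t.1.1, [])).2 (u, u))) 1)) :=
    (posTest.comp ((intSub.comp ((intMul.comp ((const _ (2 : ℤ)).pair ((zwCoord 0).comp hd))).pair hD)).pair
      (intMul.comp ((const _ (2 : ℤ)).pair ((zwCoord 1).comp hd)))) :)
  have hzero : CodeFP readInE bitE (fun t => decide (t.1.1 = 0)) := (natEq.comp ((natOfUn.comp hN).pair (const _ 0)) :)
  exact (iteP hzero (const _ false) htest).congr fun t => rfl

end PSim

end Literature.Barriers.QuantumAdvantage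

end
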